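import Summits.AtomisticToContinuum.FouriersLaw.Theses.VanishingNoiseTransfer
import Literature.MathematicalPhysics.KineticTheory.VelocityFlipNoise
import Literature.MathematicalPhysics.KineticTheory.LangevinChainResolvent
import Literature.MathematicalPhysics.KineticTheory.LangevinChainNESSProofs
import Literature.MathematicalPhysics.KineticTheory.LangevinChainLyapunov
import Literature.Probability.Process.KrylovBogoliubovDiscrete

/-!
# The weak flip steady state as `π R`, with its exponential moment (helper for stub S2
`stub_fixedLengthNoiseContinuity`)

`--supports stmt-AtomisticToContinuum-11976` helper file (crux `VanishingNoiseBound`, route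
`VanishingNoiseTransfer`, line `fekete-usc-one-length`, stub S2). Second of the files proving input
(P) of `FixedLengthNoiseContinuity.of_equidifferentiable_of_pointwise` (continuity of the unique weak
flip steady state of `L + εS` in the flip rate at `ε = 0⁺`).

`exists_isFlipSteadyState_bind_of_resolventKernel` is the construction of
`Literature/MathematicalPhysics/KineticTheory/VelocityFlipSteadyStateExists.lean`
(`exists_isFlipSteadyState_of_resolventKernel`: the chain embedded at the flip times, kernel
`K = Q ∘ₖ R`, `Q` = flip a uniformly chosen momentum, `R` an abstract resolvent-type kernel; discrete
Krylov–Bogoliubov / Foster–Lyapunov gives an invariant law `π`; `μ := π R` is a weak flip steady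
state) with its conclusion OPENED UP: the steady state is exhibited as `π.bind R` for an invariant
probability law `π` of the embedded chain whose exponential moment is bounded EXPLICITLY by the
Lyapunov constants of `R`, `∫ e^{θH} dπ ≤ b/(1 - a)` (`π = π K`, `K e^{θH} ≤ a e^{θH} + b`, and
`∫ e^{θH} dπ < ∞`). The proof is that file's, verbatim up to the last step; the representation and the
quantitative moment are what the small-noise limit needs (uniformly in the rate, the constants `a, b`
being rate-independent for `r ≤ 1` by `exists_resolventKernel_uniform`). No definitions.
-/

noncomputable section

namespace Summit.AtomisticToContinuum.FouriersLaw.Theorems.FixedLengthNoiseContinuity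

open MeasureTheory ProbabilityTheory Filter Topology
open scoped NNReal ENNReal ContDiff BoundedContinuousFunction
open Literature.MathematicalPhysics.KineticTheory.HeatConduction

/-- `x ≤ a x + b` with `x < ∞` and `a < 1` forces `x ≤ b/(1 - a)` (in `ℝ≥0∞`). -/
theorem ennreal_le_div_one_sub {x a b : ℝ≥0∞} (hx : x ≠ ⊤) (ha : a < 1) (h : x ≤ a * x + b) :
    x ≤ b / (1 - a) := by
  have h1a : 1 - a ≠ 0 := (tsub_pos_of_lt ha).ne'
  rw [ENNReal.le_div_iff_mul_le (Or.inl h1a) (Or.inl (ENNReal.sub_ne_top ENNReal.one_ne_top)),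
    ENNReal.mul_sub (fun _ _ => hx), mul_one, tsub_le_iff_right]
  calc x ≤ a * x + b := h
    _ = b + x * a := by ring

/-- **The weak flip steady state as `π R`, with its exponential moment.** Let
`P = pinnedChain ω₂ lam β γ` (`ω₂ > 0`, `lam, β ≥ 0`), `N ≥ 1`, and let `R` be a Markov kernel on
phase space with (i) the resolvent identity at rate `N ε` on `C_c^∞`:
`∫ Lf dR(z,·) = Nε (∫ f dR(z,·) - f z)`; (ii) the Feller property; (iii) a contracting bound for
`e^{θH}` (`θ > 0`): `∫ e^{θH} dR(z,·) ≤ a e^{θH(z)} + b`, `a < 1`, `b < ∞`. Then there is a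
probability measure `π` on phase space — an invariant law of the chain embedded at the flip times,
`K = Q ∘ₖ R` with `Q(z,·) = N⁻¹ ∑_i δ_{z^i}` — such that `π.bind R` is a weak flip steady state of
`L + εS` (`OscillatorChain.IsFlipSteadyState`) and `∫ e^{θH} dπ ≤ b/(1 - a)`. The construction and
proof of `exists_isFlipSteadyState_of_resolventKernel` (tree file
`VelocityFlipSteadyStateExists.lean`), with the witness and the moment of `π` exposed. -/
theorem exists_isFlipSteadyState_bind_of_resolventKernel {ω₂ lam β γ : ℝ} (hω : 0 < ω₂) (hl : 0 ≤ lam)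
    (hβ : 0 ≤ β) {N : ℕ} (hN : 0 < N) (T_L T_R ε : ℝ)
    (R : Kernel (PhaseSpace N) (PhaseSpace N)) [IsMarkovKernel R]
    (hres : ∀ f : PhaseSpace N → ℝ, ContDiff ℝ ∞ f → HasCompactSupport f → ∀ z : PhaseSpace N,
        ∫ y, (pinnedChain ω₂ lam β γ).generator N T_L T_R f y ∂(R z) =
          (N * ε) * (∫ y, f y ∂(R z) - f z))
    (hfeller : ∀ g : PhaseSpace N →ᵇ ℝ, Continuous fun z => ∫ y, g y ∂(R z))
    {θ : ℝ} (hθ : 0 < θ) {a b : ℝ≥0∞} (ha : a < 1) (hb : b ≠ ⊤)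
    (hlyap : ∀ z : PhaseSpace N,
        ∫⁻ y, ENNReal.ofReal (Real.exp (θ * (pinnedChain ω₂ lam β γ).hamiltonian N y)) ∂(R z) ≤
          a * ENNReal.ofReal (Real.exp (θ * (pinnedChain ω₂ lam β γ).hamiltonian N z)) + b) :
    ∃ π : Measure (PhaseSpace N), IsProbabilityMeasure π ∧
      (pinnedChain ω₂ lam β γ).IsFlipSteadyState N T_L T_R ε (π.bind R) ∧
      ∫⁻ y, ENNReal.ofReal (Real.exp (θ * (pinnedChain ω₂ lam β γ).hamiltonian N y)) ∂π ≤
        b / (1 - a) := by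
  -- adapted from `exists_isFlipSteadyState_of_resolventKernel`
  -- (Literature/MathematicalPhysics/KineticTheory/VelocityFlipSteadyStateExists.lean), verbatim
  -- except for the exposed witness `π` and the moment bound `hπV`
  set P := pinnedChain ω₂ lam β γ with hP
  have hN0 : (N : ℝ≥0∞) ≠ 0 := Nat.cast_ne_zero.2 hN.ne'
  have hNtop : (N : ℝ≥0∞) ≠ ⊤ := ENNReal.natCast_ne_top N
  have hNR : (N : ℝ) ≠ 0 := Nat.cast_ne_zero.2 hN.ne'
  -- bounded continuous observables are integrable for finite measures
  have hbdd_int {g : PhaseSpace N → ℝ} (hg : Continuous g) {C : ℝ} (hC : ∀ x, ‖g x‖ ≤ C)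
      (ν : Measure (PhaseSpace N)) [IsFiniteMeasure ν] : Integrable g ν :=
    (integrable_const C).mono' hg.aestronglyMeasurable (Eventually.of_forall hC)
  /- (i) the flip kernel `Q z = N⁻¹ ∑_i δ_{z^i}`: flip a uniformly chosen momentum -/
  let Q : Kernel (PhaseSpace N) (PhaseSpace N) :=
    ⟨fun z => (N : ℝ≥0∞)⁻¹ • ∑ i : Fin N, Measure.dirac (momentumFlip i z), by
      refine Measure.measurable_of_measurable_coe _ fun s hs => ?_
      simp only [Measure.smul_apply, Measure.finsetSum_apply, Measure.dirac_apply' _ hs,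
        smul_eq_mul]
      exact (Finset.measurable_sum _ fun i _ =>
        (measurable_one.indicator hs).comp (measurable_momentumFlip i)).const_mul _⟩
  have hQapply : ∀ z, Q z = (N : ℝ≥0∞)⁻¹ • ∑ i : Fin N, Measure.dirac (momentumFlip i z) :=
    fun z => rfl
  have hQlint : ∀ (W : PhaseSpace N → ℝ≥0∞) (z : PhaseSpace N),
      ∫⁻ y, W y ∂(Q z) = (N : ℝ≥0∞)⁻¹ * ∑ i : Fin N, W (momentumFlip i z) := by
    intro W z
    rw [hQapply, lintegral_smul_measure, lintegral_finsetSum_measure, smul_eq_mul]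
    simp only [lintegral_dirac]
  have hQint : ∀ (g : PhaseSpace N → ℝ) (z : PhaseSpace N),
      ∫ y, g y ∂(Q z) = (N : ℝ)⁻¹ * ∑ i : Fin N, g (momentumFlip i z) := by
    intro g z
    rw [hQapply, integral_smul_measure,
      integral_finsetSum_measure fun i _ => integrable_dirac enorm_lt_top, smul_eq_mul,
      ENNReal.toReal_inv, ENNReal.toReal_natCast]
    simp only [integral_dirac]
  haveI hQmarkov : IsMarkovKernel Q := by
    refine ⟨fun z => ⟨?_⟩⟩
    rw [hQapply, Measure.smul_apply, Measure.finsetSum_apply]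
    simp only [measure_univ, Finset.sum_const, Finset.card_univ, Fintype.card_fin, nsmul_eq_mul,
      mul_one, smul_eq_mul]
    exact ENNReal.inv_mul_cancel hN0 hNtop
  /- the Lyapunov function `V = e^{θH}`, invariant under the flips -/
  let V : PhaseSpace N → ℝ≥0 := fun x => (Real.exp (θ * P.hamiltonian N x)).toNNReal
  have hVapply : ∀ x, (V x : ℝ≥0∞) = ENNReal.ofReal (Real.exp (θ * P.hamiltonian N x)) :=
    fun x => rfl
  have hVcont : Continuous V := continuous_real_toNNReal.comp (Real.continuous_exp.comp
    (continuous_const.mul (pinnedChain_continuous_hamiltonian ω₂ lam β γ N)))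
  have hVmeas : Measurable fun x => (V x : ℝ≥0∞) :=
    measurable_coe_nnreal_ennreal.comp hVcont.measurable
  have hcpt : ∀ r : ℝ≥0, IsCompact {x | V x ≤ r} := fun r =>
    pinnedChain_isCompact_setOf_exp_le hω hl hβ γ N hθ r
  have hVflip : ∀ (i : Fin N) (x : PhaseSpace N), V (momentumFlip i x) = V x := by
    intro i x
    simp only [V, OscillatorChain.hamiltonian_momentumFlip]
  have hQV : ∀ x, ∫⁻ y, (V y : ℝ≥0∞) ∂(Q x) = V x := by
    intro x
    rw [hQlint]
    simp only [hVflip, Finset.sum_const, Finset.card_univ, Fintype.card_fin, nsmul_eq_mul]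
    rw [← mul_assoc, ENNReal.inv_mul_cancel hN0 hNtop, one_mul]
  /- (ii) the embedded chain `K = Q ∘ₖ R` is Markov, Feller and has the Lyapunov function `V` -/
  have hKlyap : ∀ z, ∫⁻ y, (V y : ℝ≥0∞) ∂((Q ∘ₖ R) z) ≤ a * V z + b := by
    intro z
    rw [Kernel.lintegral_comp _ _ _ hVmeas]
    simp_rw [hQV]
    exact hlyap z
  have hKfeller : ∀ g : PhaseSpace N →ᵇ ℝ, Continuous fun z => ∫ y, g y ∂((Q ∘ₖ R) z) := by
    intro g
    let g' : PhaseSpace N →ᵇ ℝ :=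
      (N : ℝ)⁻¹ • ∑ i : Fin N, g.compContinuous ⟨momentumFlip i, continuous_momentumFlip i⟩
    have hg' : ∀ x, ∫ y, g y ∂(Q x) = g' x := by
      intro x
      rw [hQint]
      simp only [g', BoundedContinuousFunction.coe_smul, BoundedContinuousFunction.coe_sum,
        Finset.sum_apply, BoundedContinuousFunction.compContinuous_apply, ContinuousMap.coe_mk,
        smul_eq_mul]
    have heq : (fun z => ∫ y, g y ∂((Q ∘ₖ R) z)) = fun z => ∫ x, g' x ∂(R z) := by
      funext z
      rw [Kernel.comp_apply,
        Literature.Probability.Process.MarkovChain.integral_bind_eq_integral_integral Q (R z)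
          g.continuous.stronglyMeasurable (fun x => g.norm_coe_le_norm x)]
      exact integral_congr_ae (Eventually.of_forall hg')
    rw [heq]
    exact hfeller g'
  /- (iii) discrete Krylov–Bogoliubov: an invariant probability measure `π` of `K` -/
  obtain ⟨π, hπ, hinv, hVfin⟩ :=
    Literature.Probability.Process.MarkovChain.exists_invariant_of_lyapunov (Q ∘ₖ R) hKfeller V
      hVcont hcpt ha hb hKlyap 0
  have hbindQ : (π.bind R).bind Q = π := Measure.comp_assoc.trans hinv.def
  /- the moment bound `∫ V dπ ≤ b/(1-a)` from invariance, `π = π K`, `K V ≤ a V + b` -/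
  have hπV : ∫⁻ y, (V y : ℝ≥0∞) ∂π ≤ b / (1 - a) := by
    have h1 : ∫⁻ y, (V y : ℝ≥0∞) ∂π ≤ a * ∫⁻ y, (V y : ℝ≥0∞) ∂π + b := by
      conv_lhs => rw [← hinv.def]
      have h := Literature.Probability.Process.MarkovChain.lintegral_bind_le_of_lyapunov (Q ∘ₖ R)
        hVmeas hKlyap π
      rwa [measure_univ, mul_one] at h
    exact ennreal_le_div_one_sub hVfin.ne ha h1
  /- (iv) `μ := π R` is a weak flip steady state -/
  refine ⟨π, hπ, ?_, by simpa only [hVapply] using hπV⟩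
  unfold OscillatorChain.IsFlipSteadyState
  refine ⟨inferInstance, fun f hf hfc => ?_, fun i => ?_⟩
  · -- the weak equation `∫ (L f + ε S f) d(π R) = 0`
    have hf2 : ContDiff ℝ 2 f := hf.of_le (by norm_cast)
    have hLc : Continuous (P.generator N T_L T_R f) :=
      P.continuous_generator (pinnedChain_contDiff_U ω₂ lam β γ) (pinnedChain_contDiff_V ω₂ lam β γ)
        N T_L T_R hf2
    obtain ⟨CL, hCL⟩ := P.exists_bound_generator (pinnedChain_contDiff_U ω₂ lam β γ)
      (pinnedChain_contDiff_V ω₂ lam β γ) N T_L T_R hf2 hfc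
    obtain ⟨Cf, hCf⟩ : ∃ C, ∀ x, ‖f x‖ ≤ C := hf.continuous.bounded_above_of_compact_support hfc
    -- `z ↦ R f (z)` is continuous (Feller) and bounded
    have hRf_cont : Continuous fun z => ∫ y, f y ∂(R z) := by
      simpa using hfeller (BoundedContinuousFunction.ofNormedAddCommGroup f hf.continuous Cf hCf)
    have hRf_bd : ∀ z, ‖∫ y, f y ∂(R z)‖ ≤ Cf := fun z => by
      simpa using norm_integral_le_of_norm_le_const (μ := R z) (Eventually.of_forall hCf)
    -- `x ↦ Q f (x)` is continuous and bounded
    have hQf_cont : Continuous fun x => ∫ y, f y ∂(Q x) := by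
      simp_rw [hQint]
      exact continuous_const.mul
        (continuous_finsetSum _ fun i _ => hf.continuous.comp (continuous_momentumFlip i))
    have hQf_bd : ∀ x, ‖∫ y, f y ∂(Q x)‖ ≤ Cf := fun x => by
      simpa using norm_integral_le_of_norm_le_const (μ := Q x) (Eventually.of_forall hCf)
    have hμf : ∫ x, f x ∂(π.bind R) = ∫ z, ∫ y, f y ∂(R z) ∂π :=
      Literature.Probability.Process.MarkovChain.integral_bind_eq_integral_integral R π
        hf.continuous.stronglyMeasurable hCf
    -- the generator part: resolvent identity, `∫ L f d(π R) = N ε (∫ f d(π R) - ∫ f dπ)`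
    have h1 : ∫ x, P.generator N T_L T_R f x ∂(π.bind R) =
        (N * ε) * (∫ x, f x ∂(π.bind R) - ∫ x, f x ∂π) := by
      rw [Literature.Probability.Process.MarkovChain.integral_bind_eq_integral_integral R π
        hLc.stronglyMeasurable hCL]
      simp_rw [hres f hf hfc]
      rw [integral_const_mul, integral_sub (hbdd_int hRf_cont hRf_bd π)
        (hbdd_int hf.continuous hCf π), hμf]
    -- the flip part: invariance of `π` under `Q ∘ₖ R`, `∫ S f d(π R) = N (∫ f dπ - ∫ f d(π R))`
    have hQf : ∀ x, (∑ i : Fin N, (f (momentumFlip i x) - f x)) =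
        N * ∫ y, f y ∂(Q x) - N * f x := by
      intro x
      rw [hQint, ← mul_assoc, mul_inv_cancel₀ hNR, one_mul, Finset.sum_sub_distrib]
      simp only [Finset.sum_const, Finset.card_univ, Fintype.card_fin, nsmul_eq_mul]
    have hA : Integrable (fun x => (N : ℝ) * ∫ y, f y ∂(Q x)) (π.bind R) :=
      (hbdd_int hQf_cont hQf_bd _).const_mul _
    have hB : Integrable (fun x => (N : ℝ) * f x) (π.bind R) :=
      (hbdd_int hf.continuous hCf _).const_mul _
    have hS : Integrable (fun x => ∑ i : Fin N, (f (momentumFlip i x) - f x)) (π.bind R) := by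
      simp_rw [hQf]
      exact hA.sub hB
    have h2 : ∫ x, (∑ i : Fin N, (f (momentumFlip i x) - f x)) ∂(π.bind R) =
        N * (∫ x, f x ∂π - ∫ x, f x ∂(π.bind R)) := by
      simp_rw [hQf]
      rw [integral_sub hA hB, integral_const_mul, integral_const_mul,
        ← Literature.Probability.Process.MarkovChain.integral_bind_eq_integral_integral Q (π.bind R)
          hf.continuous.stronglyMeasurable hCf, hbindQ]
      ring
    simp only [OscillatorChain.flipGenerator_apply]
    rw [integral_add (hbdd_int hLc hCL _) (hS.const_mul ε), integral_const_mul, h1, h2]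
    ring
  · -- integrable bond currents, from `∫⁻ e^{θH} d(π R) ≤ a ∫⁻ e^{θH} dπ + b < ⊤`
    refine pinnedChain_integrable_bondCurrent_of_integrable_exp hω.le hl hβ γ N hθ ?_ i
    refine ⟨(Real.continuous_exp.comp (continuous_const.mul
      (pinnedChain_continuous_hamiltonian ω₂ lam β γ N))).aestronglyMeasurable, ?_⟩
    simp only [hVapply] at hVfin
    show ∫⁻ x, ‖Real.exp (θ * P.hamiltonian N x)‖ₑ ∂(π.bind R) < ⊤
    simp only [Real.enorm_eq_ofReal (Real.exp_nonneg _)]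
    calc ∫⁻ x, ENNReal.ofReal (Real.exp (θ * P.hamiltonian N x)) ∂(π.bind R)
        ≤ a * ∫⁻ x, ENNReal.ofReal (Real.exp (θ * P.hamiltonian N x)) ∂π + b * π Set.univ :=
          Literature.Probability.Process.MarkovChain.lintegral_bind_le_of_lyapunov R hVmeas hlyap π
      _ < ⊤ := by
          rw [measure_univ, mul_one]
          exact ENNReal.add_lt_top.2 ⟨ENNReal.mul_lt_top (ha.trans_le le_top) hVfin, hb.lt_top⟩


/-- Registered helper sub-goal `helper_flipSteadyStateBind` of stmt-AtomisticToContinuum-11976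
(= `exists_isFlipSteadyState_bind_of_resolventKernel`, fully quantified, notation-free one-line
form). -/
theorem helper_flipSteadyStateBind : ∀ (ω₂ lam β γ : ℝ), 0 < ω₂ → 0 ≤ lam → 0 ≤ β → ∀ (N : ℕ), 0 < N → ∀ (T_L T_R ε : ℝ) (R : ProbabilityTheory.Kernel (Literature.MathematicalPhysics.KineticTheory.HeatConduction.PhaseSpace N) (Literature.MathematicalPhysics.KineticTheory.HeatConduction.PhaseSpace N)) [ProbabilityTheory.IsMarkovKernel R], (∀ f : Literature.MathematicalPhysics.KineticTheory.HeatConduction.PhaseSpace N → ℝ, ContDiff ℝ ((⊤ : ℕ∞) : WithTop ℕ∞) f → HasCompactSupport f → ∀ z : Literature.MathematicalPhysics.KineticTheory.HeatConduction.PhaseSpace N, MeasureTheory.integral (R z) (fun y => (Literature.MathematicalPhysics.KineticTheory.HeatConduction.pinnedChain ω₂ lam β γ).generator N T_L T_R f y) = ((N : ℝ) * ε) * (MeasureTheory.integral (R z) (fun y => f y) - f z)) → (∀ g : BoundedContinuousFunction (Literature.MathematicalPhysics.KineticTheory.HeatConduction.PhaseSpace N) ℝ, Continuous fun z => MeasureTheory.integral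 (R z) (fun y => g y)) → ∀ θ : ℝ, 0 < θ → ∀ a b : ENNReal, a < 1 → b ≠ (⊤ : ENNReal) → (∀ z : Literature.MathematicalPhysics.KineticTheory.HeatConduction.PhaseSpace N, MeasureTheory.lintegral (R z) (fun y => ENNReal.ofReal (Real.exp (θ * (Literature.MathematicalPhysics.KineticTheory.HeatConduction.pinnedChain ω₂ lam β γ).hamiltonian N y))) ≤ a * ENNReal.ofReal (Real.exp (θ * (Literature.MathematicalPhysics.KineticTheory.HeatConduction.pinnedChain ω₂ lam β γ).hamiltonian N z)) + b) → ∃ π : MeasureTheory.Measure (Literature.MathematicalPhysics.KineticTheory.HeatConduction.PhaseSpace N), MeasureTheory.IsProbabilityMeasure π ∧ (Literature.MathematicalPhysics.KineticTheory.HeatConduction.pinnedChain ω₂ lam β γ).IsFlipSteadyState N T_L T_R ε (π.bind R) ∧ MeasureTheory.lintegral π (fun y => ENNReal.ofReal (Real.exp (θ * (Literature.MathematicalPhysics.KineticTheory.HeatConduction.pinnedChain ω₂ lam β γ).hamiltonian N y))) ≤ b / (1 - a) :=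
  fun _ _ _ _ hω hl hβ _ hN T_L T_R ε R _ hres hfeller _ hθ _ _ ha hb hlyap =>
    exists_isFlipSteadyState_bind_of_resolventKernel hω hl hβ hN T_L T_R ε R hres hfeller hθ ha hb hlyap

end Summit.AtomisticToContinuum.FouriersLaw.Theorems.FixedLengthNoiseContinuity

end
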